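/-
Copyright: publication-cell `pub-balaban` (b2b), seat b2b-balaban-pv06 gen 10.  Literature leaf —
finite bookkeeping only; every theorem is kernel-proved and tagged [folklore]; NO cited facts,
NO new named facts.
-/
import Mathlib.Analysis.SpecialFunctions.Log.Basic
import Literature.MathematicalPhysics.QuantumFieldTheory.Balaban1983to89.T4TerritoryReflection

/-!
# T4 — locality of localized sums (the print-side shape of the background oscillation O2′(b2))

Fourth leaf of the lower-half reduction of the territory comparison E2-rel (b)
(`T4TerritoryComparison.TerritoryLowerBound`; cell records `t4/T4-EST-U5Ea-E2relb.md` v1.3.x, GAPS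
G-pv06g10-3 and its ADDENDUM).  Its sibling `T4LogDetOscillation` proves the background-oscillation
volume law for a Gaussian block normalisation OUTRIGHT in the model (`|log det M − log det M'| ≤
(1/c) Σ|Mᵢⱼ − M'ᵢⱼ|`).  This leaf types the OTHER route to the same inequality — the one the printed
text takes for its own normalisation factors — as abstract finite bookkeeping on hypotheses, so that
the word «routine» in the cell's census («for print's normalisation factors the (b2) volume law is a
routine consequence of the localized analytic representation of [log Z^{(k)}(U_{k+1}) − log Z^{(k)}(1)]
and of the anchored family bound») is a kernel-checked implication and not an adjective.

## The printed shape (LOCATED, quoted for orientation; NOT used as a hypothesis of any kind)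

[B13] = T. Bałaban, Renormalization group approach to lattice gauge field theories. II, Commun. Math.
Phys. 116 (1988) 1–22, p.21: «The effective action in (I.1.6) is obtained by adding to the above action
the expression [log Z^{(k)}(U_{k+1}) − log Z^{(k)}(1)]. For this expression we construct the
representation (I.1.7) using the generalized random walk expansion for Z^{(k)}(U_{k+1}). … We gather
all terms in the expansions, localized in X, and we extend them to analytic functions of U, J. The
expression localized in X satisfies the bound (I.1.18) with κ replaced by δ₀M, and with an absolute
constant instead of E₀.»  [B12] = part I, Commun. Math. Phys. 109 (1987) 249–301, p.257 (0.24):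
the localized pieces are «depending on U restricted to X, and satisfying the inequality
|E^{(j)}(X, U)| ≤ E₀ exp(−κ d_j(X))»; [B13] (1.26) p.8: «Σ_{X∈D_j, X⊃□′} exp(−κ d_j(X)) ≤ O(1)»
(in the tree as the hypothesis shape `B13FamilySum.Ineq126`).

## What is proved (abstractly: a finite catalogue `S` of domains `Y` with footprints `cubes Y`,
pieces `E Y U ∈ ℝ` for configurations `U` of an arbitrary type, a finite set `W` of cubes)

* `eq_of_dependsOn_of_disjoint` (L0): «depends on `U` restricted to the footprint» + «`U = U'` off
  `W`» ⇒ the piece is unchanged when the footprint is disjoint from `W`.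
* `abs_sum_sub_sum_le_two_mul_sum_filter` (L1, locality of localized sums): pieces with footprint
  disjoint from `W` coincide, pieces meeting `W` are bounded by `β` ⇒
  `|Σ_Y E(Y,U) − Σ_Y E(Y,U')| ≤ 2 Σ_{Y meeting W} β(Y)`.
* `sum_filter_not_disjoint_le_card_mul` (L2, anchored resummation): `β ≥ 0` and
  `Σ_{Y ∋ c} β(Y) ≤ B` for the cubes `c` of `W` ⇒ `Σ_{Y meeting W} β(Y) ≤ #W · B`.
* `abs_sum_sub_sum_le_card_mul` (L3, the volume law): `|Σ_Y E(Y,U) − Σ_Y E(Y,U')| ≤ 2B · #W`;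
  `exp_sum_le_exp_mul_exp_sum` (L3′): the ratio form `exp Σ E(·,U') ≤ exp(2B · #W) · exp Σ E(·,U)`.
* `normLocality_of_log_oscillation` (L4): transport of `T4TerritoryReflection.NormLocality` from a
  positive reference normalisation `nT'` to `nT` along `log nT' − log nT ≤ c_B · cost` (pointwise at
  pending territories), constants `(cN, slackN) ↦ (cN + c_B, slackN)` — the form in which (L3) with
  `2B · #W ≤ c_B · cost` (the cell's bookkeeping (b2-R): the region where the actual and the
  re-inserted backgrounds differ, counted in cubes, is charged to the pending component's cost) feeds
  the consumer `T4TerritoryReflection.territoryLowerBound_of_reflection`.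

## Honest scope

The hypotheses `hloc` / `hdep` (localisation), `hbU`, `hbU'` (size of the pieces meeting `W`) and
`hanch` (anchored family bound) are the READINGS of (0.24)/(I.1.18), p.21 and (1.26) quoted above, to be
supplied by a consumer; whether Bałaban's localized pieces of log Z^{(k)} satisfy them with an absolute
per-cube constant is the B13 cell's open point G-B13-12a, not settled here.  Nothing is cited; the file
decides no disputed step; it is NOT a proof of E2-rel (b) and NOT summit progress.  The identification
(b1) of the re-inserted normalisation and the model claim (M) are untouched.
-/

open Finset

namespace Literature.MathematicalPhysics.QuantumFieldTheory.Balaban1983to89.T4LocalizedOscillation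

section Localized

variable {Dom Cube Cfg : Type*}

/-- (L0) Pieces that depend on the configuration only through its restriction to their footprint are
unchanged when two configurations agree off a set `W` of cubes disjoint from the footprint. [folklore] -/
theorem eq_of_dependsOn_of_disjoint {Pt G : Type*} (cubes : Dom → Finset Cube) (pt : Pt → Cube)
    (E : Dom → (Pt → G) → ℝ)
    (hdep : ∀ Y (U U' : Pt → G), (∀ p, pt p ∈ cubes Y → U p = U' p) → E Y U = E Y U')
    (W : Finset Cube) {U U' : Pt → G} (hagree : ∀ p, pt p ∉ W → U p = U' p)
    (Y : Dom) (hdis : Disjoint (cubes Y) W) : E Y U = E Y U' :=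
  hdep Y U U' fun p hp => hagree p (Finset.disjoint_left.mp hdis hp)

variable [DecidableEq Cube]

/-- (L1) **Locality of localized sums.** If the pieces with footprint disjoint from `W` coincide for the
two configurations and the pieces with footprint meeting `W` are bounded by `β`, the two localized sums
differ by at most twice the `β`-mass of the domains meeting `W`. [folklore] -/
theorem abs_sum_sub_sum_le_two_mul_sum_filter (S : Finset Dom) (cubes : Dom → Finset Cube)
    (E : Dom → Cfg → ℝ) (β : Dom → ℝ) (W : Finset Cube) {U U' : Cfg}
    (hloc : ∀ Y ∈ S, Disjoint (cubes Y) W → E Y U = E Y U')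
    (hbU : ∀ Y ∈ S, ¬ Disjoint (cubes Y) W → |E Y U| ≤ β Y)
    (hbU' : ∀ Y ∈ S, ¬ Disjoint (cubes Y) W → |E Y U'| ≤ β Y) :
    |∑ Y ∈ S, E Y U - ∑ Y ∈ S, E Y U'|
      ≤ 2 * ∑ Y ∈ S.filter (fun Y => ¬ Disjoint (cubes Y) W), β Y := by
  rw [← Finset.sum_sub_distrib]
  have hsplit : ∑ Y ∈ S, (E Y U - E Y U')
      = ∑ Y ∈ S.filter (fun Y => ¬ Disjoint (cubes Y) W), (E Y U - E Y U') := by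
    rw [Finset.sum_filter]
    refine Finset.sum_congr rfl fun Y hY => ?_
    by_cases h : Disjoint (cubes Y) W
    · rw [if_neg (not_not.mpr h), hloc Y hY h, sub_self]
    · rw [if_pos h]
  rw [hsplit, Finset.mul_sum]
  refine (Finset.abs_sum_le_sum_abs _ _).trans (Finset.sum_le_sum fun Y hY => ?_)
  rw [Finset.mem_filter] at hY
  calc |E Y U - E Y U'| ≤ |E Y U| + |E Y U'| := abs_sub _ _
    _ ≤ β Y + β Y := add_le_add (hbU Y hY.1 hY.2) (hbU' Y hY.1 hY.2)
    _ = 2 * β Y := by ring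

/-- (L2) **Anchored resummation over `W`.** If `β ≥ 0` and the anchored sums `Σ_{Y ∋ c} β(Y)` are `≤ B`
for every cube `c` of `W` (the shape of `B13FamilySum.Ineq126`, B13 (1.26), restricted to the cubes of
`W`), then the `β`-mass of the domains meeting `W` is at most `#W · B`. [folklore] -/
theorem sum_filter_not_disjoint_le_card_mul (S : Finset Dom) (cubes : Dom → Finset Cube)
    (W : Finset Cube) (β : Dom → ℝ) (B : ℝ) (hβ : ∀ Y ∈ S, 0 ≤ β Y)
    (hanch : ∀ c ∈ W, ∑ Y ∈ S.filter (fun Y => c ∈ cubes Y), β Y ≤ B) :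
    ∑ Y ∈ S.filter (fun Y => ¬ Disjoint (cubes Y) W), β Y ≤ (W.card : ℝ) * B := by
  set g : Dom → Cube → ℝ := fun Y c => if c ∈ cubes Y then β Y else 0 with hg
  have h1 : ∑ Y ∈ S.filter (fun Y => ¬ Disjoint (cubes Y) W), β Y ≤ ∑ Y ∈ S, ∑ c ∈ W, g Y c := by
    rw [Finset.sum_filter]
    refine Finset.sum_le_sum fun Y hY => ?_
    have hg0 : ∀ c ∈ W, 0 ≤ g Y c := fun c _ => by
      simp only [hg]; split_ifs <;> [exact hβ Y hY; exact le_rfl]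
    by_cases h : Disjoint (cubes Y) W
    · rw [if_neg (not_not.mpr h)]
      exact Finset.sum_nonneg hg0
    · rw [if_pos h]
      obtain ⟨c, hcY, hcW⟩ := Finset.not_disjoint_iff.mp h
      calc β Y = g Y c := by simp only [hg, if_pos hcY]
        _ ≤ ∑ c ∈ W, g Y c := Finset.single_le_sum hg0 hcW
  have h2 : ∑ Y ∈ S, ∑ c ∈ W, g Y c = ∑ c ∈ W, ∑ Y ∈ S.filter (fun Y => c ∈ cubes Y), β Y := by
    rw [Finset.sum_comm]
    refine Finset.sum_congr rfl fun c _ => ?_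
    rw [Finset.sum_filter]
  have h3 : ∑ c ∈ W, ∑ Y ∈ S.filter (fun Y => c ∈ cubes Y), β Y ≤ ∑ c ∈ W, B :=
    Finset.sum_le_sum hanch
  calc ∑ Y ∈ S.filter (fun Y => ¬ Disjoint (cubes Y) W), β Y
      ≤ ∑ c ∈ W, ∑ Y ∈ S.filter (fun Y => c ∈ cubes Y), β Y := h1.trans_eq h2
    _ ≤ ∑ c ∈ W, B := h3
    _ = (W.card : ℝ) * B := by rw [Finset.sum_const, nsmul_eq_mul]

/-- (L3) **The volume law for localized sums**: under (L1)'s locality and (L2)'s anchored bound, two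
localized sums over configurations agreeing off `W` differ by at most `2 B · #W`. [folklore] -/
theorem abs_sum_sub_sum_le_card_mul (S : Finset Dom) (cubes : Dom → Finset Cube)
    (E : Dom → Cfg → ℝ) (β : Dom → ℝ) (B : ℝ) (W : Finset Cube) {U U' : Cfg}
    (hloc : ∀ Y ∈ S, Disjoint (cubes Y) W → E Y U = E Y U')
    (hbU : ∀ Y ∈ S, ¬ Disjoint (cubes Y) W → |E Y U| ≤ β Y)
    (hbU' : ∀ Y ∈ S, ¬ Disjoint (cubes Y) W → |E Y U'| ≤ β Y)
    (hβ : ∀ Y ∈ S, 0 ≤ β Y)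
    (hanch : ∀ c ∈ W, ∑ Y ∈ S.filter (fun Y => c ∈ cubes Y), β Y ≤ B) :
    |∑ Y ∈ S, E Y U - ∑ Y ∈ S, E Y U'| ≤ 2 * B * W.card := by
  calc |∑ Y ∈ S, E Y U - ∑ Y ∈ S, E Y U'|
      ≤ 2 * ∑ Y ∈ S.filter (fun Y => ¬ Disjoint (cubes Y) W), β Y :=
        abs_sum_sub_sum_le_two_mul_sum_filter S cubes E β W hloc hbU hbU'
    _ ≤ 2 * ((W.card : ℝ) * B) := by
        have := sum_filter_not_disjoint_le_card_mul S cubes W β B hβ hanch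
        linarith
    _ = 2 * B * W.card := by ring

/-- (L3′) The same in ratio form for the exponentials `n(U) = exp (Σ_Y E(Y, U))`:
`n(U') ≤ exp (2 B · #W) · n(U)`. [folklore] -/
theorem exp_sum_le_exp_mul_exp_sum (S : Finset Dom) (cubes : Dom → Finset Cube)
    (E : Dom → Cfg → ℝ) (β : Dom → ℝ) (B : ℝ) (W : Finset Cube) {U U' : Cfg}
    (hloc : ∀ Y ∈ S, Disjoint (cubes Y) W → E Y U = E Y U')
    (hbU : ∀ Y ∈ S, ¬ Disjoint (cubes Y) W → |E Y U| ≤ β Y)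
    (hbU' : ∀ Y ∈ S, ¬ Disjoint (cubes Y) W → |E Y U'| ≤ β Y)
    (hβ : ∀ Y ∈ S, 0 ≤ β Y)
    (hanch : ∀ c ∈ W, ∑ Y ∈ S.filter (fun Y => c ∈ cubes Y), β Y ≤ B) :
    Real.exp (∑ Y ∈ S, E Y U') ≤ Real.exp (2 * B * W.card) * Real.exp (∑ Y ∈ S, E Y U) := by
  have h := abs_sum_sub_sum_le_card_mul S cubes E β B W hloc hbU hbU' hβ hanch
  rw [← Real.exp_add]
  exact Real.exp_le_exp.mpr (by linarith [(abs_le.mp h).1])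

end Localized

section Packaging

open MeasureTheory T4HistoryPeeling T4InsertionProfile T4TerritoryComparison T4TerritoryReflection

variable {ι : Type*} {T : Finset ι} {n : ℕ} {σ : Type*} {Ω : Type*} [MeasurableSpace Ω]
variable {Φ : SwitchOff T n} {Aω : ι → ℝ} {μ : Measure Ω} {F : FibreModel T Aω μ}
  {X : TerritoryFactorisation Φ F} {shape : Fin n → ι → σ} {cost : Fin n → σ → ℝ}

/-- (L4) **Transport of `NormLocality` along a logarithmic oscillation bound.** If `NormLocality`
holds for a positive reference normalisation `nT'` with constants `(cN, slackN)` and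
`log nT' − log nT ≤ cB · cost` pointwise at pending territories (as delivered by (L3) with
`2 B · #W ≤ cB · cost`), then it holds for `nT` with constants `(cN + cB, slackN)`. [folklore] -/
theorem normLocality_of_log_oscillation {nT nT' : Fin n → ι → Ω → ℝ} {cN cB : ℝ}
    {slackN : Fin n → σ → ℝ}
    (h' : NormLocality Φ X shape cost nT' cN slackN)
    (hpos : ∀ i, ∀ τ ∈ T, Φ.pend i τ = true → ∀ ω, 0 < nT i τ ω)
    (hpos' : ∀ i, ∀ τ ∈ T, Φ.pend i τ = true → ∀ ω, 0 < nT' i τ ω)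
    (hlog : ∀ i, ∀ τ ∈ T, Φ.pend i τ = true → ∀ ω,
      Real.log (nT' i τ ω) - Real.log (nT i τ ω) ≤ cB * cost i (shape i τ)) :
    NormLocality Φ X shape cost nT (cN + cB) slackN := by
  intro i τ hτ hp ω
  have h1 := h' i τ hτ hp ω
  have h0 := hpos i τ hτ hp ω
  have h0' := hpos' i τ hτ hp ω
  have h2 : nT' i τ ω ≤ Real.exp (cB * cost i (shape i τ)) * nT i τ ω := by
    have h3 := hlog i τ hτ hp ω
    calc nT' i τ ω = Real.exp (Real.log (nT' i τ ω)) := (Real.exp_log h0').symm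
      _ ≤ Real.exp (cB * cost i (shape i τ) + Real.log (nT i τ ω)) :=
          Real.exp_le_exp.mpr (by linarith)
      _ = Real.exp (cB * cost i (shape i τ)) * nT i τ ω := by
          rw [Real.exp_add, Real.exp_log h0]
  set a := cN * cost i (shape i τ) + slackN i (shape i τ) with ha
  set b := cB * cost i (shape i τ) with hb
  have hsplit : Real.exp (-((cN + cB) * cost i (shape i τ) + slackN i (shape i τ)))
      = Real.exp (-b) * Real.exp (-a) := by
    rw [← Real.exp_add]; congr 1; ring
  rw [hsplit, mul_assoc]
  calc Real.exp (-b) * (Real.exp (-a) * X.norm i τ ω)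
      ≤ Real.exp (-b) * nT' i τ ω := mul_le_mul_of_nonneg_left h1 (Real.exp_nonneg _)
    _ ≤ Real.exp (-b) * (Real.exp b * nT i τ ω) := mul_le_mul_of_nonneg_left h2 (Real.exp_nonneg _)
    _ = nT i τ ω := by rw [← mul_assoc, ← Real.exp_add, neg_add_cancel, Real.exp_zero, one_mul]

end Packaging

section Sanity

/-- Sanity (non-vacuity of (L3) on a non-degenerate instance): two domains `0, 1` with singleton
footprints `{0}, {1}`, `W = {0}`, localized pieces `E Y U = U Y` for configurations `U : Fin 2 → ℝ`,
`U = (1, 5)`, `U' = (-1, 5)` (agreeing off `W`), `β = 1`, `B = 1`: `|6 − 4| = 2 ≤ 2 · 1 · 1`. -/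
example : |∑ Y ∈ (Finset.univ : Finset (Fin 2)), (![1, 5] : Fin 2 → ℝ) Y
      - ∑ Y ∈ (Finset.univ : Finset (Fin 2)), (![-1, 5] : Fin 2 → ℝ) Y| ≤ 2 * 1 * ({0} : Finset (Fin 2)).card := by
  refine abs_sum_sub_sum_le_card_mul (Cfg := Fin 2 → ℝ) Finset.univ (fun Y => {Y})
    (fun Y U => U Y) (fun _ => 1) 1 {0} ?_ ?_ ?_ (fun _ _ => zero_le_one) ?_
  · intro Y _ hY
    fin_cases Y
    · simp at hY
    · simp
  · intro Y _ hY
    fin_cases Y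
    · simp
    · exact (hY (by simp)).elim
  · intro Y _ hY
    fin_cases Y
    · simp
    · exact (hY (by simp)).elim
  · intro c hc
    rw [Finset.mem_singleton] at hc; subst hc
    simp [Finset.filter_eq]

end Sanity

end Literature.MathematicalPhysics.QuantumFieldTheory.Balaban1983to89.T4LocalizedOscillation
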